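import Literature.AnabelianGeometry.SemiGraphs.PSCCoveringBranchDataProofs
import Literature.AnabelianGeometry.SemiGraphs.PSCCoveringDescentProofs
import HarnessLib

/-!
# [CombGC] Theorem 1.6 (ii): graphicity of `α` from the STURDY LEVEL (Rmk. 1.1.5 + Prop. 1.2 (ii) + Prop. 1.5 (ii))

Mochizuki, *A combinatorial version of the Grothendieck conjecture*, Tohoku Math. J. **59** (2007)
[CombGC], proof of Theorem 1.6 (ii), author's manuscript p. 14, l.12–16: "let us first observe that by
functoriality; Proposition 1.2, (ii); Proposition 1.5, (ii), it follows that we may always replace `G`,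
`H` by finite étale `Π_G`- or `Π_H`-coverings that correspond via `α`.  In particular, by Remark 1.1.5,
we may assume without loss of generality that `G`, `H` are sturdy."  This proof-only file is the
writer's composition of that reduction (cell sub-DAG `plan/L3/SUBDAG-CombGC-Thm16.md`, rows T16-L06 /
T16-L07 / T16-L00 (ii), §ASSEMBLY SPEC steps (A), (G), (H)) over abc-iut-L3-t4's covering data
`PSCDatum.restrictBD` (`PSCCoveringBranchData(Proofs).lean`) and `restrictIso`
(`PSCCoveringDatumTransport.lean`), and abc-iut-w4-d052's descent `PSCCoveringDescentProofs.lean`: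

* `level_correspondence_of_restrict` — bookkeeping: a correspondence of traces `B.subgroupOf U`
  under `α_U = restrictIso α` is a correspondence of the subgroups `U ⊓ B` under `α`;
* `isGroupTheoreticallyVerticial_of_restrictBD` / `…EdgeLike…` — if `α_U` is group-theoretically
  verticial (resp. edge-like) between the covering data `G.restrictBD U`, `H.restrictBD (α U)` (`U`
  open normal of finite index) and verticial / edge-like subgroups are commensurably terminal in `Π_G`,
  `Π_H` (Prop. 1.2 (ii)), then `α` is group-theoretically verticial (resp. edge-like);
* `isGraphic_of_restrictBD_level` — hence, with Prop. 1.5 (ii) for `(G, H, α)`, `α` is graphic;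
* `isGraphic_of_sturdyCase` — the origin-level reduction: granting (displayed schemata, BY NAME where
  typed) commensurable terminality `CommensurableTerminalityHolds Ω`, Prop. 1.5 (ii)
  `GraphicIffEdgeLikeVerticialHolds Ω`, coverings of PSC-type `RestrictBDOfPSCTypeHolds Ω`, a sturdy
  open normal level for every datum (Rmk. 1.1.5, genus form `hcover`), and THE STURDY CASE of Thm. 1.6
  (ii) in the form "sturdy data of `Ω`-type on profinite groups, `Σ = {l}`, `α` graphically
  filtration-preserving ⇒ `α` group-theoretically verticial and edge-like" (`hsturdy`, the remaining
  rows of the sub-DAG), every graphically filtration-preserving `α` between data of `Ω`-type on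
  profinite groups with `Σ = {l}` is graphic.

Proof-only (0 defs); nothing here takes a side on [IUTchIII] Cor. 3.12.
[cite: MochizukiCombGC2007, Thm 1.6(ii) p.14] [cite: MochizukiCombGC2007, Rmk 1.1.5 p.8]
-/

noncomputable section

namespace Literature.AnabelianGeometry.SemiGraphs

namespace PSCDatum

open PSCCovering

universe u

variable {P : Type u} [Group P] [TopologicalSpace P] [IsTopologicalGroup P]
variable {P' : Type u} [Group P'] [TopologicalSpace P'] [IsTopologicalGroup P']

/-! ### Traces under `α_U` versus intersections under `α` -/

omit [IsTopologicalGroup P] [IsTopologicalGroup P'] in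
/-- Bookkeeping: if `α_U = restrictIso α` carries the traces `B.subgroupOf U` (`S B`) onto the traces
`B'.subgroupOf U'` (`S' B'`) and every one of the latter arises, then `α` carries the subgroups `U ⊓ B`
onto the `U' ⊓ B'` and every one of the latter arises. [cite: MochizukiCombGC2007, Thm 1.6(ii) p.14] -/
theorem level_correspondence_of_restrict (α : P ≃ₜ* P') {U : Subgroup P} {U' : Subgroup P'}
    (h : U.map α.toMulEquiv.toMonoidHom = U') {S : Subgroup P → Prop} {S' : Subgroup P' → Prop}
    (hto : ∀ A : Subgroup U, (∃ B, S B ∧ A = B.subgroupOf U) →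
      ∃ B', S' B' ∧ A.map (restrictIso α h).toMulEquiv.toMonoidHom = B'.subgroupOf U')
    (hfrom : ∀ A' : Subgroup U', (∃ B', S' B' ∧ A' = B'.subgroupOf U') →
      ∃ A : Subgroup U, (∃ B, S B ∧ A = B.subgroupOf U) ∧
        A.map (restrictIso α h).toMulEquiv.toMonoidHom = A') :
    (∀ D : Subgroup P, (∃ B, S B ∧ D = U ⊓ B) →
        ∃ B', S' B' ∧ D.map α.toMulEquiv.toMonoidHom = U' ⊓ B') ∧
      ∀ D' : Subgroup P', (∃ B', S' B' ∧ D' = U' ⊓ B') →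
        ∃ D : Subgroup P, (∃ B, S B ∧ D = U ⊓ B) ∧ D.map α.toMulEquiv.toMonoidHom = D' := by
  -- `α (U ⊓ B) = image in Π_H of α_U (B.subgroupOf U)`
  have key : ∀ B : Subgroup P, (U ⊓ B).map α.toMulEquiv.toMonoidHom =
      ((B.subgroupOf U).map (restrictIso α h).toMulEquiv.toMonoidHom).map U'.subtype := by
    intro B
    rw [map_subtype_map_restrictIso, Subgroup.subgroupOf_map_subtype, inf_comm]
  refine ⟨?_, ?_⟩
  · rintro D ⟨B, hB, rfl⟩
    obtain ⟨B', hB', hA⟩ := hto (B.subgroupOf U) ⟨B, hB, rfl⟩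
    refine ⟨B', hB', ?_⟩
    rw [key, hA, Subgroup.subgroupOf_map_subtype, inf_comm]
  · rintro D' ⟨B', hB', rfl⟩
    obtain ⟨A, ⟨B, hB, rfl⟩, hA⟩ := hfrom (B'.subgroupOf U') ⟨B', hB', rfl⟩
    refine ⟨U ⊓ B, ⟨B, hB, rfl⟩, ?_⟩
    rw [key, hA, Subgroup.subgroupOf_map_subtype, inf_comm]

/-! ### Descent of Def. 1.4 (iv) from `α_U` on the covering data `restrictBD` -/

section Level

variable (G : PSCDatum P) (H : PSCDatum P') (α : P ≃ₜ* P')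
  {U : Subgroup P} [U.Normal] [U.FiniteIndex] (hU : IsOpen (U : Set P))
  {U' : Subgroup P'} [U'.FiniteIndex] (hU' : IsOpen (U' : Set P'))
  (h : U.map α.toMulEquiv.toMonoidHom = U') (bd : G.BranchData) (bd' : H.BranchData)

/-- **"We may replace `G`, `H` by finite étale coverings that correspond via `α`" — verticial part.**
If `α_U` is group-theoretically verticial between the covering data `G_{U}`, `H_{α U}` (open normal
`U` of finite index, any branch data) and verticial / edge-like subgroups are commensurably terminal in
`Π_G`, `Π_H` (Prop. 1.2 (ii)), then `α` is group-theoretically verticial.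
[cite: MochizukiCombGC2007, Thm 1.6(ii) p.14] -/
theorem isGroupTheoreticallyVerticial_of_restrictBD
    (hG : G.VerticialEdgeLikeCommensurablyTerminal) (hH : H.VerticialEdgeLikeCommensurablyTerminal)
    (hlev : (G.restrictBD U hU bd).IsGroupTheoreticallyVerticial (H.restrictBD U' hU' bd')
      (restrictIso α h)) :
    G.IsGroupTheoreticallyVerticial H α := by
  subst h
  obtain ⟨h₁, h₂⟩ := level_correspondence_of_restrict α rfl (S := G.IsVerticial) (S' := H.IsVerticial)
    (fun A hA => (isVerticial_restrictBD_iff' hU' bd' _).mp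
      (hlev.1 A ((isVerticial_restrictBD_iff' hU bd A).mpr hA)))
    (fun A' hA' => by
      obtain ⟨A, hA, hAA'⟩ := hlev.2 A' ((isVerticial_restrictBD_iff' hU' bd' A').mpr hA')
      exact ⟨A, (isVerticial_restrictBD_iff' hU bd A).mp hA, hAA'⟩)
  exact G.isGroupTheoreticallyVerticial_of_level H α hG hH h₁ h₂

/-- **The same, edge-like part**: if `α_U` is group-theoretically edge-like between `G_U`, `H_{α U}`,
then `α` is group-theoretically edge-like. [cite: MochizukiCombGC2007, Thm 1.6(ii) p.14] -/
theorem isGroupTheoreticallyEdgeLike_of_restrictBD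
    (hG : G.VerticialEdgeLikeCommensurablyTerminal) (hH : H.VerticialEdgeLikeCommensurablyTerminal)
    (hlev : (G.restrictBD U hU bd).IsGroupTheoreticallyEdgeLike (H.restrictBD U' hU' bd')
      (restrictIso α h)) :
    G.IsGroupTheoreticallyEdgeLike H α := by
  subst h
  obtain ⟨h₁, h₂⟩ := level_correspondence_of_restrict α rfl (S := G.IsEdgeLike) (S' := H.IsEdgeLike)
    (fun A hA => (isEdgeLike_restrictBD_iff' hU' bd' _).mp
      (hlev.1 A ((isEdgeLike_restrictBD_iff' hU bd A).mpr hA)))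
    (fun A' hA' => by
      obtain ⟨A, hA, hAA'⟩ := hlev.2 A' ((isEdgeLike_restrictBD_iff' hU' bd' A').mpr hA')
      exact ⟨A, (isEdgeLike_restrictBD_iff' hU bd A).mp hA, hAA'⟩)
  exact G.isGroupTheoreticallyEdgeLike_of_level H α hG hH h₁ h₂

/-- **… and cuspidal part**: if `α_U` is group-theoretically cuspidal between `G_U`, `H_{α U}`, then
`α` is group-theoretically cuspidal. [cite: MochizukiCombGC2007, Thm 1.6(i) p.13] -/
theorem isGroupTheoreticallyCuspidal_of_restrictBD
    (hG : G.VerticialEdgeLikeCommensurablyTerminal) (hH : H.VerticialEdgeLikeCommensurablyTerminal)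
    (hlev : (G.restrictBD U hU bd).IsGroupTheoreticallyCuspidal (H.restrictBD U' hU' bd')
      (restrictIso α h)) :
    G.IsGroupTheoreticallyCuspidal H α := by
  subst h
  obtain ⟨h₁, h₂⟩ := level_correspondence_of_restrict α rfl (S := G.IsCuspidal) (S' := H.IsCuspidal)
    (fun A hA => (isCuspidal_restrictBD_iff' hU' bd' _).mp
      (hlev.1 A ((isCuspidal_restrictBD_iff' hU bd A).mpr hA)))
    (fun A' hA' => by
      obtain ⟨A, hA, hAA'⟩ := hlev.2 A' ((isCuspidal_restrictBD_iff' hU' bd' A').mpr hA')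
      exact ⟨A, (isCuspidal_restrictBD_iff' hU bd A).mp hA, hAA'⟩)
  exact G.isGroupTheoreticallyCuspidal_of_level H α hG hH h₁ h₂

/-- **Graphicity from one Galois level** (p. 14, l.12–14): if at some open normal finite-index level
`U` the isomorphism `α_U` of the covering data is group-theoretically verticial and edge-like, then —
granted Prop. 1.2 (ii) for `G`, `H` and Prop. 1.5 (ii) for `(G, H, α)` — `α` is graphic.
[cite: MochizukiCombGC2007, Thm 1.6(ii) p.14] -/
theorem isGraphic_of_restrictBD_level
    (hG : G.VerticialEdgeLikeCommensurablyTerminal) (hH : H.VerticialEdgeLikeCommensurablyTerminal)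
    (hP15 : G.GraphicIffEdgeLikeVerticial H α)
    (hv : (G.restrictBD U hU bd).IsGroupTheoreticallyVerticial (H.restrictBD U' hU' bd')
      (restrictIso α h))
    (he : (G.restrictBD U hU bd).IsGroupTheoreticallyEdgeLike (H.restrictBD U' hU' bd')
      (restrictIso α h)) :
    G.IsGraphic H α :=
  hP15.1.mpr ⟨G.isGroupTheoreticallyEdgeLike_of_restrictBD H α hU hU' h bd bd' hG hH he,
    G.isGroupTheoreticallyVerticial_of_restrictBD H α hU hU' h bd bd' hG hH hv⟩

end Level

/-! ### The origin-level reduction to the sturdy case -/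

section Origin

variable (Ω : PSCOrigin.{u})

/-- **[CombGC] Thm. 1.6 (ii) ⇐ REDUCED TO ITS STURDY CASE** (p. 14, l.12–16: "we may always replace
`G`, `H` by finite étale … coverings that correspond via `α`.  In particular, by Remark 1.1.5, we may
assume without loss of generality that `G`, `H` are sturdy").  Granted — Prop. 1.2 (ii)
(`CommensurableTerminalityHolds Ω`), Prop. 1.5 (ii) (`GraphicIffEdgeLikeVerticialHolds Ω`), coverings of
PSC-type (`RestrictBDOfPSCTypeHolds Ω`), a sturdy open normal level below which all coverings are
sturdy (Rmk. 1.1.5, displayed in genus form as `hcover`), and the STURDY CASE `hsturdy` (sturdy data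
of `Ω`-type on profinite groups with `Σ = {l}`: graphically filtration-preserving ⇒ group-theoretically
verticial and edge-like) — every graphically filtration-preserving `α : Π_G ⥲ Π_H` between data of
`Ω`-type on profinite groups with `Σ_G = Σ_H = {l}` is graphic.
[cite: MochizukiCombGC2007, Thm 1.6(ii) p.14] -/
theorem isGraphic_of_sturdyCase (hCT : CommensurableTerminalityHolds Ω)
    (hP15 : GraphicIffEdgeLikeVerticialHolds Ω) (hres : RestrictBDOfPSCTypeHolds Ω)
    (hcover : ∀ ⦃R : Type u⦄ [Group R] [TopologicalSpace R] [IsTopologicalGroup R] (K : PSCDatum R),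
      Ω.IsOfPSCType K → ∃ U₀ : Subgroup R, IsOpen (U₀ : Set R) ∧ U₀.Normal ∧
        ∀ (U : Subgroup R) [U.FiniteIndex] (hU : IsOpen (U : Set R)) (bd : K.BranchData),
          U ≤ U₀ → (K.restrictBD U hU bd).IsSturdy)
    {l : ℕ}
    (hsturdy : ∀ ⦃R : Type u⦄ [Group R] [TopologicalSpace R] [IsTopologicalGroup R] [CompactSpace R]
      [TotallyDisconnectedSpace R]
      ⦃R' : Type u⦄ [Group R'] [TopologicalSpace R'] [IsTopologicalGroup R'] [CompactSpace R']
      [TotallyDisconnectedSpace R']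
      (K : PSCDatum R) (L : PSCDatum R') (γ : R ≃ₜ* R'),
      Ω.IsOfPSCType K → Ω.IsOfPSCType L → K.IsSturdy → L.IsSturdy → K.Sigma = {l} → L.Sigma = {l} →
        K.IsGraphicallyFiltrationPreserving L γ →
          K.IsGroupTheoreticallyVerticial L γ ∧ K.IsGroupTheoreticallyEdgeLike L γ)
    ⦃R : Type u⦄ [Group R] [TopologicalSpace R] [IsTopologicalGroup R] [CompactSpace R]
    [TotallyDisconnectedSpace R]
    ⦃R' : Type u⦄ [Group R'] [TopologicalSpace R'] [IsTopologicalGroup R'] [CompactSpace R']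
    [TotallyDisconnectedSpace R']
    {G : PSCDatum R} {H : PSCDatum R'} {α : R ≃ₜ* R'} (hGΩ : Ω.IsOfPSCType G) (hHΩ : Ω.IsOfPSCType H)
    (hS : G.Sigma = {l}) (hS' : H.Sigma = {l}) (hα : G.IsGraphicallyFiltrationPreserving H α) :
    G.IsGraphic H α := by
  -- sturdy levels for `G` and `H`; a common open normal level `U ≤ U₀`, `α U ≤ V₀`
  obtain ⟨U₀, hU₀o, hU₀n, hU₀⟩ := hcover G hGΩ
  obtain ⟨V₀, hV₀o, hV₀n, hV₀⟩ := hcover H hHΩ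
  haveI := hU₀n
  haveI := hV₀n
  set U : Subgroup R := U₀ ⊓ V₀.comap α.toMulEquiv.toMonoidHom with hUdef
  have hUo : IsOpen (U : Set R) := by
    rw [hUdef, Subgroup.coe_inf, Subgroup.coe_comap]
    exact hU₀o.inter (hV₀o.preimage α.continuous)
  haveI hUn : U.Normal := Subgroup.normal_inf_normal U₀ (V₀.comap α.toMulEquiv.toMonoidHom)
  haveI hUf : U.FiniteIndex := finiteIndex_of_isOpen U hUo
  set U' : Subgroup R' := U.map α.toMulEquiv.toMonoidHom with hU'def
  have hU'o : IsOpen (U' : Set R') := by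
    rw [hU'def, Subgroup.coe_map]
    exact α.toHomeomorph.isOpenMap _ hUo
  haveI hU'f : U'.FiniteIndex := finiteIndex_of_isOpen U' hU'o
  have hUU₀ : U ≤ U₀ := inf_le_left
  have hU'V₀ : U' ≤ V₀ := by
    rintro _ ⟨x, hx, rfl⟩
    exact (inf_le_right : U ≤ V₀.comap α.toMulEquiv.toMonoidHom) hx
  -- the covering data: of `Ω`-type (for suitable branch data), sturdy, `Σ = {l}`
  obtain ⟨bd, hbd⟩ := hres G hGΩ
  obtain ⟨bd', hbd'⟩ := hres H hHΩ
  have hGUΩ : Ω.IsOfPSCType (G.restrictBD U hUo bd) := hbd U hUo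
  have hHUΩ : Ω.IsOfPSCType (H.restrictBD U' hU'o bd') := hbd' U' hU'o
  have hGUs : (G.restrictBD U hUo bd).IsSturdy := hU₀ U hUo bd hUU₀
  have hHUs : (H.restrictBD U' hU'o bd').IsSturdy := hV₀ U' hU'o bd' hU'V₀
  -- the open subgroups are profinite
  haveI : CompactSpace U := isCompact_iff_compactSpace.mp (Subgroup.isClosed_of_isOpen U hUo).isCompact
  haveI : CompactSpace U' :=
    isCompact_iff_compactSpace.mp (Subgroup.isClosed_of_isOpen U' hU'o).isCompact
  -- the sturdy case at the level, then descend
  obtain ⟨hv, he⟩ := hsturdy (G.restrictBD U hUo bd) (H.restrictBD U' hU'o bd') (restrictIso α rfl)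
    hGUΩ hHUΩ hGUs hHUs (by rw [restrictBD_Sigma, hS]) (by rw [restrictBD_Sigma, hS'])
    (hα.restrictBD G H α hUo hU'o rfl bd bd')
  exact G.isGraphic_of_restrictBD_level H α hUo hU'o rfl bd bd' (hCT G hGΩ).1 (hCT H hHΩ).1
    (hP15 G H α hGΩ hHΩ) hv he

end Origin

end PSCDatum

end Literature.AnabelianGeometry.SemiGraphs

end
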